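import Summits.ValiantsHypothesis.ValiantsHypothesis.Theorems.LacunarySymmetroidMatrixDescartesCensusDoorA34RootWitness

/-!
# `MatrixDescartes` census — DOOR A at `(3,4)`: the FLAG LAW (no `(5, ≥ 1)` flag past a middle-eigenvalue root)

HONEST FRAMING.  Object-search cell `pub-symmetroid`, door-A seat `val-sym-door-p3`; item stmt-ValiantsHypothesis-19980
`DoorA34 = PosRootLawAt 3 4 18` is OPEN and asserted nowhere in this file.  The cell's one named MECHANISM for a `(3,4)`
nineteen is the graft / FLAG LEMMA (CONJECTURE.md §2.1c, paper-proved): a `(3,3)` nine-row `F` with roots `< T₁`, an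
orthonormal flag `(u₁,u₂,u₃)`, the level-1 compression `p₁ = det F|_{u₁^⊥}` with `γ₁` sign changes in `(T₁,T₂)` and the
level-2 compression `p₂ = u₃ᵀ F u₃` with `γ₂` sign changes beyond `T₂`, grafted by a hierarchical top letter, give
`9 + 3 + γ₁ + γ₂` roots; `19` needs the FULL flag `(γ₁, γ₂) = (5, 2)`.  This file proves, for ALL supports and with no
definiteness hypothesis, the elementary law that closes that flag past any root of middle-eigenvalue type:

* `flagLaw_no_five_one` — **FLAG LAW.**  Let `F(x) = Σ_l x^{d l} S_l` be a real symmetric `3 × 3` pencil with THREE letters,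
  `r > 0` a det-root of TYPE `(−)` (`tr adj F(r) < 0`: `F(r)` indefinite, the census's middle-eigenvalue roots), and let the
  coordinate level-1 compression `g = e₃ᵀ adj F e₃ = det F|_{span(e₁,e₂)}` have five distinct roots in an interval `(r, z)`.
  Then NO vector `u ≠ 0` of the plane `span(e₁,e₂)` has `uᵀ F(z) u = 0`: the level-2 trinomials have no root beyond the
  five.  So `(γ₁, γ₂) = (5, ≥ 1)` is impossible past a type-`(−)` root; a `(5,2)` graft needs a source row ALL of whose
  roots below `T₁` are of type `(+)` (definite-edge roots) — none of the `63` census nine-rows (all middle-eigenvalue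
  oscillators, seat report DOOR-A34-P3G5 §2), while a `(5,0)` flag DOES occur (this seat's exact certificate
  `HOME/val-sym-door-p3/g6/flagjoint/CERT_gamma1_5_seed1.json`).
  Proof: `g` lives on the `≤ 6` pair sums (`signVariations ≤ 5`), so by Descartes WITH multiplicity the five roots are simple
  and are all the positive roots; hence `g(r) · g(z) < 0` (`eval_mul_eval_sign_of_roots_between`).  But `g(r) ≤ 0` at a
  type-`(−)` root (`quadForm_adjugate_nonpos_of_type_neg`, the rank-one adjugate) and `g(z) = det F(z)|_{e₃^⊥} ≤ 0` as soon
  as the `2 × 2` compression has an isotropic vector (`det_topLeft_nonpos_of_isotropic`).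
* general-`K` bookkeeping reused from the `(3,4)` files: `support_quadForm_adjugate_pencil_subset'`, `eval_quadForm_adjugate_pencil'`,
  `card_pairSums_three_le`, `signVariations_quadForm_adjugate_pencil_three_le`.

Nothing here bounds `ζ_sym(3,4)`; the FLAG LEMMA itself is not a kernel theorem; `DoorA34` stays OPEN; nothing bears on
`MatrixDescartes` (stmt-ValiantsHypothesis-18050) or `VP ≠ VNP`.

[folklore] Descartes' rule with multiplicity (Mathlib `roots_countP_pos_le_signVariations`), the intermediate value theorem,
`2 × 2` definiteness; elementary.
-/

-- `Summit.ValiantsHypothesis.ValiantsHypothesis.…` repeats a component by the D-0017 layout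
-- (single-conjunct summit), which the `dupNamespace` linter flags; the name is mandated.
set_option linter.dupNamespace false

namespace Summit.ValiantsHypothesis.ValiantsHypothesis.Theorems.LacunarySymmetroidMatrixDescartes.Census

open Polynomial Finset
open scoped BigOperators Polynomial Matrix

/-! ## The adjugate quadratic form of a `3 × 3` pencil with any number of letters -/

/-- Every adjugate entry of the `3 × 3` pencil (any number `K` of letters) is supported on the pair sums. [folklore] -/
theorem support_adjugate_pencil_apply_subset' {K : ℕ} (d : Fin K → ℕ) (S : Fin K → Matrix (Fin 3) (Fin 3) ℝ)
    (i j : Fin 3) :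
    ((∑ l, ((X : ℝ[X]) ^ d l) • (S l).map C).adjugate i j).support
      ⊆ (Finset.univ : Finset (Fin 2 → Fin K)).image (fun f => ∑ i, d (f i)) := by
  rw [Matrix.adjugate_fin_succ_eq_det_submatrix, submatrix_pencil₂]
  rcases neg_one_pow_eq_or ℝ[X] (j + i : ℕ) with h | h
  · rw [h, one_mul]; exact support_det_pencil_subset_sumset d _
  · rw [h, neg_one_mul, Polynomial.support_neg]; exact support_det_pencil_subset_sumset d _

/-- The quadratic form `Σ_{i,j} c_i c_j (adj P)_{ij}` of the adjugate pencil lives on the pair sums (any `K`). [folklore] -/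
theorem support_quadForm_adjugate_pencil_subset' {K : ℕ} (d : Fin K → ℕ) (S : Fin K → Matrix (Fin 3) (Fin 3) ℝ)
    (c : Fin 3 → ℝ) :
    (∑ i, ∑ j, C (c i * c j) * (∑ l, ((X : ℝ[X]) ^ d l) • (S l).map C).adjugate i j).support
      ⊆ (Finset.univ : Finset (Fin 2 → Fin K)).image (fun f => ∑ i, d (f i)) := by
  intro n hn
  by_contra hni
  apply (Polynomial.mem_support_iff.mp hn)
  rw [Polynomial.finsetSum_coeff]
  refine Finset.sum_eq_zero fun i _ => ?_
  rw [Polynomial.finsetSum_coeff]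
  refine Finset.sum_eq_zero fun j _ => ?_
  rw [Polynomial.coeff_C_mul]
  have h0 : ((∑ l, ((X : ℝ[X]) ^ d l) • (S l).map C).adjugate i j).coeff n = 0 :=
    Polynomial.notMem_support_iff.mp fun h => hni (support_adjugate_pencil_apply_subset' d S i j h)
  rw [h0, mul_zero]

/-- Evaluation of the adjugate quadratic form (any `K`): `cᵀ adj P(x) c`. [folklore] -/
theorem eval_quadForm_adjugate_pencil' {K : ℕ} (d : Fin K → ℕ) (S : Fin K → Matrix (Fin 3) (Fin 3) ℝ)
    (c : Fin 3 → ℝ) (x : ℝ) :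
    (∑ i, ∑ j, C (c i * c j) * (∑ l, ((X : ℝ[X]) ^ d l) • (S l).map C).adjugate i j).eval x
      = c ⬝ᵥ ((∑ l, x ^ d l • S l).adjugate *ᵥ c) := by
  set M := (∑ l, ((X : ℝ[X]) ^ d l) • (S l).map C) with hM
  have h2 : M.adjugate.map (eval x) = (M.map (eval x)).adjugate := by
    have := RingHom.map_adjugate (evalRingHom x) M
    simpa [RingHom.mapMatrix_apply, Polynomial.coe_evalRingHom] using this
  have h3 : ∀ i j, (M.adjugate i j).eval x = (∑ l, x ^ d l • S l).adjugate i j := by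
    intro i j
    have := congrFun (congrFun h2 i) j
    rw [Matrix.map_apply] at this
    rw [this, hM, map_eval_pencil]
  simp only [Polynomial.eval_finsetSum, Polynomial.eval_mul, Polynomial.eval_C, h3, dotProduct, Matrix.mulVec,
    Finset.mul_sum]
  refine Finset.sum_congr rfl fun i _ => Finset.sum_congr rfl fun j _ => ?_
  ring

/-- Three exponents have at most `6` pair sums. [folklore] -/
theorem card_pairSums_three_le (d : Fin 3 → ℕ) :
    ((Finset.univ : Finset (Fin 2 → Fin 3)).image (fun f => ∑ i, d (f i))).card ≤ 6 := by
  classical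
  have hsub : (Finset.univ : Finset (Fin 2 → Fin 3)).image (fun f => ∑ i, d (f i)) ⊆
      ((Finset.univ : Finset (Fin 3 × Fin 3)).filter (fun p => p.1 ≤ p.2)).image (fun p => d p.1 + d p.2) := by
    intro x hx
    obtain ⟨g, _, rfl⟩ := Finset.mem_image.mp hx
    rw [Fin.sum_univ_two]
    rcases le_total (g 0) (g 1) with h | h
    · exact Finset.mem_image.mpr ⟨(g 0, g 1), Finset.mem_filter.mpr ⟨Finset.mem_univ _, h⟩, rfl⟩
    · exact Finset.mem_image.mpr ⟨(g 1, g 0), Finset.mem_filter.mpr ⟨Finset.mem_univ _, h⟩, by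
        simp only; ring⟩
  have hcard : ((Finset.univ : Finset (Fin 3 × Fin 3)).filter (fun p => p.1 ≤ p.2)).card = 6 := by decide
  exact (Finset.card_le_card hsub).trans (Finset.card_image_le.trans hcard.le)

/-- **The level-1 compression of a `(3,3)` pencil has at most `5` sign variations** (a `6`-nomial), for every `c`. [folklore] -/
theorem signVariations_quadForm_adjugate_pencil_three_le (d : Fin 3 → ℕ) (S : Fin 3 → Matrix (Fin 3) (Fin 3) ℝ)
    (c : Fin 3 → ℝ) :
    (∑ i, ∑ j, C (c i * c j) * (∑ l, ((X : ℝ[X]) ^ d l) • (S l).map C).adjugate i j).signVariations ≤ 5 := by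
  set g := ∑ i, ∑ j, C (c i * c j) * (∑ l, ((X : ℝ[X]) ^ d l) • (S l).map C).adjugate i j with hg
  by_cases h0 : g = 0
  · rw [h0]; simp
  · have h1 := Literature.Computability.AlgebraicComplexity.signVariations_lt_card_support h0
    have h2 : g.support.card ≤ 6 :=
      (Finset.card_le_card (support_quadForm_adjugate_pencil_subset' d S c)).trans (card_pairSums_three_le d)
    omega

/-! ## Two elementary sign facts -/

/-- For the third coordinate vector, `e₃ᵀ adj A e₃ = (adj A)₃₃ = A₁₁A₂₂ − A₁₂A₂₁`, the determinant of the top-left `2 × 2`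
block. [folklore] -/
theorem quadForm_adjugate_single_two (A : Matrix (Fin 3) (Fin 3) ℝ) :
    (Pi.single (2 : Fin 3) (1 : ℝ)) ⬝ᵥ (A.adjugate *ᵥ Pi.single (2 : Fin 3) (1 : ℝ))
      = A 0 0 * A 1 1 - A 0 1 * A 1 0 := by
  rw [Matrix.adjugate_fin_three]
  simp [Matrix.mulVec, dotProduct, Fin.sum_univ_three]

/-- **An isotropic vector in the plane forces the `2 × 2` compression to be non-definite**: if `A` is symmetric, `u ≠ 0` lies
in `span(e₁,e₂)` (`u₃ = 0`) and `uᵀ A u = 0`, then `A₁₁A₂₂ − A₁₂A₂₁ ≤ 0`. [folklore] -/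
theorem det_topLeft_nonpos_of_isotropic {A : Matrix (Fin 3) (Fin 3) ℝ} (hA : A.IsSymm) {u : Fin 3 → ℝ}
    (hu2 : u 2 = 0) (hu : u ≠ 0) (hiso : u ⬝ᵥ (A *ᵥ u) = 0) :
    A 0 0 * A 1 1 - A 0 1 * A 1 0 ≤ 0 := by
  have h10 : A 1 0 = A 0 1 := by
    have := congrFun (congrFun hA 0) 1
    simp only [Matrix.transpose_apply] at this
    exact this
  have hq : A 0 0 * u 0 ^ 2 + 2 * A 0 1 * (u 0 * u 1) + A 1 1 * u 1 ^ 2 = 0 := by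
    have := hiso
    simp [Matrix.mulVec, dotProduct, Fin.sum_univ_three, hu2, h10] at this
    linear_combination this
  have hne : u 0 ≠ 0 ∨ u 1 ≠ 0 := by
    by_contra h
    push Not at h
    apply hu
    ext i; fin_cases i
    · exact h.1
    · exact h.2
    · exact hu2
  rw [h10]
  by_contra hpos
  push Not at hpos
  -- det > 0 ⇒ A₀₀ ≠ 0 and the form is definite
  have ha : A 0 0 ≠ 0 := by
    intro h0; rw [h0] at hpos; nlinarith [sq_nonneg (A 0 1)]
  -- A₀₀ · q(u) = (A₀₀ u₀ + A₀₁ u₁)² + det · u₁²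
  have key : A 0 0 * (A 0 0 * u 0 ^ 2 + 2 * A 0 1 * (u 0 * u 1) + A 1 1 * u 1 ^ 2)
      = (A 0 0 * u 0 + A 0 1 * u 1) ^ 2 + (A 0 0 * A 1 1 - A 0 1 * A 0 1) * u 1 ^ 2 := by ring
  rw [hq, mul_zero] at key
  have h1 : (A 0 0 * A 1 1 - A 0 1 * A 0 1) * u 1 ^ 2 ≥ 0 := mul_nonneg hpos.le (sq_nonneg _)
  have h2 : (A 0 0 * u 0 + A 0 1 * u 1) ^ 2 ≥ 0 := sq_nonneg _
  have h3 : u 1 ^ 2 = 0 := by nlinarith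
  have hu1 : u 1 = 0 := by simpa using h3
  have h4 : (A 0 0 * u 0 + A 0 1 * u 1) ^ 2 = 0 := by nlinarith
  have h5 : A 0 0 * u 0 = 0 := by rw [hu1] at h4; simpa using h4
  rcases hne with h | h
  · exact h ((mul_eq_zero.mp h5).resolve_left ha)
  · exact h hu1

/-! ## Sign of a Descartes-sharp polynomial outside its positive roots -/

/-- **Sign rule outside the roots.**  If a non-zero real polynomial `g` has at most `|Y|` positive roots counted WITH
multiplicity and the points of `Y` are roots inside `(r, z)`, `0 < r`, then `(−1)^{|Y|} g(r) g(z) > 0`: the roots in `Y` are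
simple, there is no other positive root, and `g` changes sign exactly at each of them. [folklore] -/
theorem eval_mul_eval_sign_of_roots_between (g : ℝ[X]) (hg : g ≠ 0) {r z : ℝ} (hr : 0 < r) (hrz : r < z)
    (Y : Finset ℝ) (hY : ∀ y ∈ Y, r < y ∧ y < z ∧ g.IsRoot y)
    (hcount : g.roots.countP (fun x => 0 < x) ≤ Y.card) :
    0 < (-1) ^ Y.card * (g.eval r * g.eval z) := by
  classical
  -- the product of the linear factors divides `g`
  set q : ℝ[X] := (Y.val.map fun a => X - C a).prod with hq
  have hle : Y.val ≤ g.roots := by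
    rw [Multiset.le_iff_count]
    intro a
    by_cases ha : a ∈ Y
    · rw [Multiset.count_eq_one_of_mem Y.nodup ha]
      exact Multiset.one_le_count_iff_mem.mpr ((Polynomial.mem_roots hg).mpr (hY a ha).2.2)
    · rw [Multiset.count_eq_zero_of_notMem (fun h => ha h)]
      exact Nat.zero_le _
  obtain ⟨h, hgh⟩ : q ∣ g := (Multiset.prod_X_sub_C_dvd_iff_le_roots hg Y.val).mpr hle
  have hh0 : h ≠ 0 := by
    rintro rfl; exact hg (by rw [hgh, mul_zero])
  have hq0 : q ≠ 0 := by
    rintro h0; exact hg (by rw [hgh, h0, zero_mul])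
  -- `h` has no positive root
  have hroots : g.roots = Y.val + h.roots := by
    rw [hgh, Polynomial.roots_mul (by rw [← hgh]; exact hg), hq, Polynomial.roots_multiset_prod_X_sub_C]
  have hcountY : Y.val.countP (fun x => 0 < x) = Y.card := by
    have : Y.val.countP (fun x => 0 < x) = Multiset.card Y.val :=
      Multiset.countP_eq_card.mpr fun a ha => hr.trans (hY a ha).1
    simpa using this
  have hcounth : h.roots.countP (fun x => 0 < x) = 0 := by
    have : g.roots.countP (fun x => 0 < x) = Y.card + h.roots.countP (fun x => 0 < x) := by
      rw [hroots, Multiset.countP_add, hcountY]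
    omega
  have hnz : ∀ w, 0 < w → h.eval w ≠ 0 := by
    intro w hw hw0
    have hmem : w ∈ h.roots := (Polynomial.mem_roots hh0).mpr hw0
    have : 0 < h.roots.countP (fun x => 0 < x) := Multiset.countP_pos.mpr ⟨w, hmem, hw⟩
    omega
  -- `h(r)` and `h(z)` have the same (non-zero) sign, by the intermediate value theorem
  have hz : 0 < z := hr.trans hrz
  have hcont : ContinuousOn (fun x => h.eval x) (Set.Icc r z) := h.continuous.continuousOn
  have hsame : 0 < h.eval r * h.eval z := by
    rcases lt_trichotomy (h.eval r) 0 with h1 | h1 | h1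
    · rcases lt_trichotomy (h.eval z) 0 with h2 | h2 | h2
      · exact mul_pos_of_neg_of_neg h1 h2
      · exact absurd h2 (hnz z hz)
      · obtain ⟨w, hw, hw0⟩ := intermediate_value_Icc hrz.le hcont ⟨h1.le, h2.le⟩
        exact absurd hw0 (hnz w (hr.trans_le hw.1))
    · exact absurd h1 (hnz r hr)
    · rcases lt_trichotomy (h.eval z) 0 with h2 | h2 | h2
      · obtain ⟨w, hw, hw0⟩ := intermediate_value_Icc' hrz.le hcont ⟨h2.le, h1.le⟩
        exact absurd hw0 (hnz w (hr.trans_le hw.1))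
      · exact absurd h2 (hnz z hz)
      · exact mul_pos h1 h2
  -- evaluation of the linear factors
  have hqeval : ∀ x, q.eval x = ∏ y ∈ Y, (x - y) := by
    intro x
    have e1 : q = ∏ y ∈ Y, (X - C y) := by
      rw [hq, Finset.prod_eq_multiset_prod]
    rw [e1, Polynomial.eval_prod]
    refine Finset.prod_congr rfl fun y _ => ?_
    rw [Polynomial.eval_sub, Polynomial.eval_X, Polynomial.eval_C]
  have hqz : 0 < q.eval z := by
    rw [hqeval]; exact Finset.prod_pos fun y hy => sub_pos.mpr (hY y hy).2.1
  have hqr : 0 < (-1) ^ Y.card * q.eval r := by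
    rw [hqeval, ← Finset.prod_const (-1 : ℝ), ← Finset.prod_mul_distrib]
    exact Finset.prod_pos fun y hy => by have := (hY y hy).1; nlinarith
  have : (-1) ^ Y.card * (g.eval r * g.eval z)
      = ((-1) ^ Y.card * q.eval r) * q.eval z * (h.eval r * h.eval z) := by
    rw [hgh, Polynomial.eval_mul, Polynomial.eval_mul]; ring
  rw [this]
  exact mul_pos (mul_pos hqr hqz) hsame

/-! ## The flag law -/

/-- **FLAG LAW — no `(5, ≥ 1)` flag past a middle-eigenvalue root.**  Let `F(x) = Σ_l x^{d l} S_l` be a real symmetric `3 × 3`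
pencil with three letters, `r > 0` a det-root of TYPE `(−)` (`tr adj F(r) < 0`), and suppose the coordinate level-1 compression
`g = e₃ᵀ adj F e₃ = det F|_{span(e₁,e₂)}` has five distinct roots in `(r, z)` (membership in `g.roots`, so `g ≠ 0`).  Then no
`u ≠ 0` of the plane `span(e₁,e₂)` is isotropic for `F(z)`: the level-2 trinomials `uᵀ F(x) u` have no root at `z` — `z` being
any point beyond the five, no root beyond the level-1 window.  Consequently the FULL flag `(γ₁, γ₂) = (5, 2)` of the graft
mechanism (CONJECTURE.md §2.1c) cannot be carried past any root of type `(−)`: a `(5,2)` graft needs a source row all of whose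
roots below the first threshold are of type `(+)`. [folklore] -/
theorem flagLaw_no_five_one (d : Fin 3 → ℕ) (S : Fin 3 → Matrix (Fin 3) (Fin 3) ℝ) (hS : ∀ l, (S l).IsSymm)
    {r z : ℝ} (hr : 0 < r) (hrz : r < z)
    (hroot : (∑ l, r ^ d l • S l).det = 0) (htype : (∑ l, r ^ d l • S l).adjugate.trace < 0)
    (Y : Finset ℝ) (hYcard : Y.card = 5)
    (hY : ∀ y ∈ Y, r < y ∧ y < z ∧
      y ∈ (∑ i, ∑ j, C ((Pi.single (2 : Fin 3) (1 : ℝ) : Fin 3 → ℝ) i * (Pi.single (2 : Fin 3) (1 : ℝ) : Fin 3 → ℝ) j) *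
        (∑ l, ((X : ℝ[X]) ^ d l) • (S l).map C).adjugate i j).roots)
    (u : Fin 3 → ℝ) (hu : u ≠ 0) (hu2 : u 2 = 0) (hiso : u ⬝ᵥ ((∑ l, z ^ d l • S l) *ᵥ u) = 0) : False := by
  classical
  set c : Fin 3 → ℝ := Pi.single (2 : Fin 3) (1 : ℝ) with hc
  set g := ∑ i, ∑ j, C (c i * c j) * (∑ l, ((X : ℝ[X]) ^ d l) • (S l).map C).adjugate i j with hgdef
  have hne : Y.Nonempty := by rw [← Finset.card_pos, hYcard]; norm_num
  obtain ⟨y₀, hy₀⟩ := hne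
  have hg0 : g ≠ 0 := (Polynomial.mem_roots'.mp (hY y₀ hy₀).2.2).1
  have hY' : ∀ y ∈ Y, r < y ∧ y < z ∧ g.IsRoot y := fun y hy =>
    ⟨(hY y hy).1, (hY y hy).2.1, (Polynomial.mem_roots'.mp (hY y hy).2.2).2⟩
  -- Descartes with multiplicity: at most five positive roots
  have hcount : g.roots.countP (fun x => 0 < x) ≤ Y.card := by
    rw [hYcard]
    exact (Polynomial.roots_countP_pos_le_signVariations g).trans
      (signVariations_quadForm_adjugate_pencil_three_le d S c)
  have hsign := eval_mul_eval_sign_of_roots_between g hg0 hr hrz Y hY' hcount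
  rw [hYcard] at hsign
  have hprod : g.eval r * g.eval z < 0 := by
    have h5 : (-1 : ℝ) ^ 5 = -1 := by norm_num
    rw [h5] at hsign; linarith
  -- `g(r) ≤ 0` at the type-(−) root (rank-one adjugate with negative weight)
  have hgr : g.eval r ≤ 0 := by
    rw [hgdef, eval_quadForm_adjugate_pencil']
    exact quadForm_adjugate_nonpos_of_type_neg (isSymm_pencil_eval d hS r) hroot htype c
  -- `g(z) ≤ 0` from the isotropic vector of the `2 × 2` compression
  have hgz : g.eval z ≤ 0 := by
    rw [hgdef, eval_quadForm_adjugate_pencil', hc, quadForm_adjugate_single_two]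
    exact det_topLeft_nonpos_of_isotropic (isSymm_pencil_eval d hS z) hu2 hu hiso
  have : 0 ≤ g.eval r * g.eval z := mul_nonneg_of_nonpos_of_nonpos hgr hgz
  linarith

/-! ## Appended (same seat): the mirrored law at the BOTTOM end -/

/-- **FLAG LAW at the bottom end** (mirror of `flagLaw_no_five_one`): if the five distinct roots of the coordinate level-1
compression `g = e₃ᵀ adj F e₃` lie in `(z, r)` BELOW a det-root `r` of type `(−)`, then no `u ≠ 0` of `span(e₁,e₂)` is
isotropic for `F(z)`.  So the full flag `(5,2)` of a BOTTOM-end graft (`x ↦ x⁻¹` in the FLAG LEMMA) is likewise impossible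
past — i.e. above — any middle-eigenvalue root. [folklore] -/
theorem flagLaw_no_five_one_below (d : Fin 3 → ℕ) (S : Fin 3 → Matrix (Fin 3) (Fin 3) ℝ) (hS : ∀ l, (S l).IsSymm)
    {r z : ℝ} (hz : 0 < z) (hzr : z < r)
    (hroot : (∑ l, r ^ d l • S l).det = 0) (htype : (∑ l, r ^ d l • S l).adjugate.trace < 0)
    (Y : Finset ℝ) (hYcard : Y.card = 5)
    (hY : ∀ y ∈ Y, z < y ∧ y < r ∧
      y ∈ (∑ i, ∑ j, C ((Pi.single (2 : Fin 3) (1 : ℝ) : Fin 3 → ℝ) i * (Pi.single (2 : Fin 3) (1 : ℝ) : Fin 3 → ℝ) j) *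
        (∑ l, ((X : ℝ[X]) ^ d l) • (S l).map C).adjugate i j).roots)
    (u : Fin 3 → ℝ) (hu : u ≠ 0) (hu2 : u 2 = 0) (hiso : u ⬝ᵥ ((∑ l, z ^ d l • S l) *ᵥ u) = 0) : False := by
  classical
  set c : Fin 3 → ℝ := Pi.single (2 : Fin 3) (1 : ℝ) with hc
  set g := ∑ i, ∑ j, C (c i * c j) * (∑ l, ((X : ℝ[X]) ^ d l) • (S l).map C).adjugate i j with hgdef
  have hne : Y.Nonempty := by rw [← Finset.card_pos, hYcard]; norm_num
  obtain ⟨y₀, hy₀⟩ := hne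
  have hg0 : g ≠ 0 := (Polynomial.mem_roots'.mp (hY y₀ hy₀).2.2).1
  have hY' : ∀ y ∈ Y, z < y ∧ y < r ∧ g.IsRoot y := fun y hy =>
    ⟨(hY y hy).1, (hY y hy).2.1, (Polynomial.mem_roots'.mp (hY y hy).2.2).2⟩
  have hcount : g.roots.countP (fun x => 0 < x) ≤ Y.card := by
    rw [hYcard]
    exact (Polynomial.roots_countP_pos_le_signVariations g).trans
      (signVariations_quadForm_adjugate_pencil_three_le d S c)
  have hsign := eval_mul_eval_sign_of_roots_between g hg0 hz hzr Y hY' hcount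
  rw [hYcard] at hsign
  have hprod : g.eval z * g.eval r < 0 := by
    have h5 : (-1 : ℝ) ^ 5 = -1 := by norm_num
    rw [h5] at hsign; linarith
  have hgr : g.eval r ≤ 0 := by
    rw [hgdef, eval_quadForm_adjugate_pencil']
    exact quadForm_adjugate_nonpos_of_type_neg (isSymm_pencil_eval d hS r) hroot htype c
  have hgz : g.eval z ≤ 0 := by
    rw [hgdef, eval_quadForm_adjugate_pencil', hc, quadForm_adjugate_single_two]
    exact det_topLeft_nonpos_of_isotropic (isSymm_pencil_eval d hS z) hu2 hu hiso
  have : 0 ≤ g.eval z * g.eval r := mul_nonneg_of_nonpos_of_nonpos hgz hgr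
  linarith

end Summit.ValiantsHypothesis.ValiantsHypothesis.Theorems.LacunarySymmetroidMatrixDescartes.Census
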